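import Summits.CriticalPhenomena.Ising3D.IsingColumnFaceL11CensusDistinctCoreTrg

/-!
# The catalogue census of §7.3 as kernel facts, IX: the distinct-values machine, part 4 — the separation constants,
the PART CHECK and its meaning (cell `pub-ising3x`, seat recog-1; paper §1.6 / §7.3)

HONEST FRAMING: lottery ticket; floor = tightest certified 3D Ising CFT bounds; no exact-solution
claim without a proof. Island framing: certified exclusion region at stated derivative order and
assumptions; not a determination of the 3D Ising critical exponents beyond that.

* the three separation constants in units `distU = 10¹⁸·lcm(1..32)` (certified lower ends `lo' − hi` of the
  attaining consecutive pairs of the whole segment, recog-1 gen 53 `twin.py`): `dL = 634895141943215953800`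
  (`4.3966…·10⁻¹²`, two `LIN` values), `dT = 7784836447514340614400` (`5.3910…·10⁻¹¹`, two `TRG` values),
  `dX = 5705866429986583060200` (`3.9513…·10⁻¹¹`, a `LIN` value that is not a `TRG` form and a `TRG` value);
* the per-window KERNEL CHECKS (`…DistinctP*A/B.lean`): `linPartChk Wlo Whi` — sort the window's `LIN` enclosures (tags
  `0`/`2`) by lower end (`msortT`), chain `dL`; `crossPartChk cls Wlo Whi` for each of the three class groups `clsGroup 0/1/2`
  (the kernel's per-check memory budget holds one group and the `TRG` table, not all of them) — sort the group's `LIN`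
  enclosures and the window's `TRG` enclosures (tag `1`), chain `dT` on the `TRG` list, merge the tag-`0` `LIN` enclosures with
  the `TRG` list (`mergeT`; the tag-`2` `TRG`-form tuples `(p/q)·K` are already there as `TRG` tuples), chain `dL` and the
  mixed-neighbour `dX` on the merged list;
* **`linPartChk_sound`** / **`crossPartChk_sound`** give `PartSepL/T/X`: if the checks pass (and `Wlo ≥ 3·10⁹·lcm32`), any two
  DISTINCT primitive `LIN` tuples with scaled values in `[Wlo, Whi]` are `≥ dL` apart, any two distinct canonical lowest-terms
  `TRG` tuples `≥ dT`, and a non-`TRG`-form primitive `LIN` tuple of the group and a canonical lowest-terms `TRG` tuple `≥ dX`.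
  Chain of custody: completeness puts the tuples in the window lists; `msortT_perm` /
  `mergeT_perm` + `nodup_of_gapChain` + `List.inj_on_of_nodup_map` make their enclosures distinct members of the sorted
  lists; `gapChain_pairwise` / `crossChain_pairwise` / `rel_or_rel_of_pairwise` separate those; enclosure soundness
  transfers the separation to the values.
Pure arithmetic over landed definitions and certified enclosures; no certificate, no datum, no σ–ε axiom; nothing is
recognised (§1.6); no P(M·) relevance.
lottery ticket; floor = tightest certified 3D Ising CFT bounds; no exact-solution claim without a proof.
-/

namespace Summit.CriticalPhenomena.Ising3D
namespace ColumnFaceL11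
open Set Literature.MathematicalPhysics.QuantumFieldTheory.ConformalBootstrap3D

/-! ### Separation constants and the part check -/

/-- Minimum separation of two `LIN` values, lower certified end, units `distU`:
`634895141943215953800 / distU = 4.3966…·10⁻¹²`. [folklore] -/
def dL : ℕ := 634895141943215953800

/-- Minimum separation of two `TRG` values: `7784836447514340614400 / distU = 5.3910…·10⁻¹¹`. [folklore] -/
def dT : ℕ := 7784836447514340614400

/-- Minimum separation of a non-`TRG`-form `LIN` value and a `TRG` value: `5705866429986583060200 / distU = 3.9513…·10⁻¹¹`.
[folklore] -/
def dX : ℕ := 5705866429986583060200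

/-- **The `LIN` part check** (one kernel evaluation per window): sort the window's `LIN` enclosures, chain `dL`. [folklore] -/
def linPartChk (Wlo Whi : ℕ) : Bool :=
  gapChain dL (msortT ((linGen Wlo Whi).map Prod.snd))

/-- **The mixed part check** for one `LIN` class group `cls` (one kernel evaluation per window and group — the kernel's
memory budget does not hold all classes and the `TRG` table at once; every list is consumed exactly once): merge the sorted
non-form (tag `0`) `LIN` enclosures of the group with the sorted `TRG` enclosures of the window and check `dL` and the
mixed-neighbour `dX` in one pass (`gapCrossChain`). [folklore] -/
def crossPartChk (cls : List ℕ) (Wlo Whi : ℕ) : Bool :=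
  gapCrossChain dL dX (mergeT 10000000 ((msortT ((linGenG cls Wlo Whi).map Prod.snd)).filter fun e => e.2.2 == 0)
    (msortT ((trgGen Wlo Whi).map Prod.snd)))

/-- **The `TRG` part check** (one kernel evaluation per window): sort the window's `TRG` enclosures, chain `dT`. [folklore] -/
def trgPartChk (Wlo Whi : ℕ) : Bool :=
  gapChain dT (msortT ((trgGen Wlo Whi).map Prod.snd))

/-- The three class groups of the mixed check: first non-zero index in `{0, 6}`, `{1, 5}`, `{2, 3, 4}` (3 504 / 3 504 / 5 256
of the 12 264 coefficient vectors). [folklore] -/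
def clsGroup : ℕ → List ℕ
  | 0 => [0, 6]
  | 1 => [1, 5]
  | _ => [2, 3, 4]

/-- The groups consist of classes `< 7`. [folklore] -/
theorem clsGroup_lt (g : ℕ) : ∀ i ∈ clsGroup g, i < 7 := by
  match g with
  | 0 => decide
  | 1 => decide
  | n + 2 => simp only [clsGroup]; decide

/-- Every class `< 7` is in one of the three groups. [folklore] -/
theorem mem_clsGroup_of_lt {i : ℕ} (hi : i < 7) : ∃ g, g < 3 ∧ i ∈ clsGroup g := by
  interval_cases i
  · exact ⟨0, by norm_num, by decide⟩
  · exact ⟨1, by norm_num, by decide⟩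
  · exact ⟨2, by norm_num, by decide⟩
  · exact ⟨2, by norm_num, by decide⟩
  · exact ⟨2, by norm_num, by decide⟩
  · exact ⟨1, by norm_num, by decide⟩
  · exact ⟨0, by norm_num, by decide⟩

/-! ### What a passed part check means -/

/-- Two distinct primitive `LIN` tuples with scaled values in the window are `≥ dL` apart. [folklore] -/
def PartSepL (Wlo Whi : ℕ) : Prop :=
  ∀ e e' : ℤ × List ℤ × ℕ, linTupleOK 12 e = true → linPrim e = true → linTupleOK 12 e' = true → linPrim e' = true →
    e ≠ e' → (Wlo : ℝ) ≤ (distU : ℝ) * lin7TupleVal e → (distU : ℝ) * lin7TupleVal e ≤ (Whi : ℝ) →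
    (Wlo : ℝ) ≤ (distU : ℝ) * lin7TupleVal e' → (distU : ℝ) * lin7TupleVal e' ≤ (Whi : ℝ) →
    (distU : ℝ) * lin7TupleVal e + (dL : ℝ) ≤ (distU : ℝ) * lin7TupleVal e' ∨
      (distU : ℝ) * lin7TupleVal e' + (dL : ℝ) ≤ (distU : ℝ) * lin7TupleVal e

/-- Two distinct canonical lowest-terms `TRG` tuples with scaled values in the window are `≥ dT` apart. [folklore] -/
def PartSepT (Wlo Whi : ℕ) : Prop :=
  ∀ e e' : TrgTuple, trgGTupleOK 17 32 e = true → trgCanon e = true → trgPrim e = true →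
    trgGTupleOK 17 32 e' = true → trgCanon e' = true → trgPrim e' = true →
    e ≠ e' → (Wlo : ℝ) ≤ (distU : ℝ) * trgGTupleVal e → (distU : ℝ) * trgGTupleVal e ≤ (Whi : ℝ) →
    (Wlo : ℝ) ≤ (distU : ℝ) * trgGTupleVal e' → (distU : ℝ) * trgGTupleVal e' ≤ (Whi : ℝ) →
    (distU : ℝ) * trgGTupleVal e + (dT : ℝ) ≤ (distU : ℝ) * trgGTupleVal e' ∨
      (distU : ℝ) * trgGTupleVal e' + (dT : ℝ) ≤ (distU : ℝ) * trgGTupleVal e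

/-- A non-`TRG`-form primitive `LIN` tuple OF CLASS GROUP `cls` and a canonical lowest-terms `TRG` tuple with scaled values in
the window are `≥ dX` apart. [folklore] -/
def PartSepX (cls : List ℕ) (Wlo Whi : ℕ) : Prop :=
  ∀ (e : ℤ × List ℤ × ℕ) (e' : TrgTuple), linTupleOK 12 e = true → linPrim e = true → linIsTrg e = false →
    firstNZ e.2.1 ∈ cls →
    trgGTupleOK 17 32 e' = true → trgCanon e' = true → trgPrim e' = true →
    (Wlo : ℝ) ≤ (distU : ℝ) * lin7TupleVal e → (distU : ℝ) * lin7TupleVal e ≤ (Whi : ℝ) →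
    (Wlo : ℝ) ≤ (distU : ℝ) * trgGTupleVal e' → (distU : ℝ) * trgGTupleVal e' ≤ (Whi : ℝ) →
    (distU : ℝ) * lin7TupleVal e + (dX : ℝ) ≤ (distU : ℝ) * trgGTupleVal e' ∨
      (distU : ℝ) * trgGTupleVal e' + (dX : ℝ) ≤ (distU : ℝ) * lin7TupleVal e

/-- From an enclosure-level separation to the values. [folklore] -/
theorem val_sep_of_enc_sep {a b : Enc} {x y : ℝ} {d : ℕ}
    (ha : ((a.1 : ℕ) : ℝ) ≤ x ∧ x ≤ ((a.2.1 : ℕ) : ℝ)) (hb : ((b.1 : ℕ) : ℝ) ≤ y ∧ y ≤ ((b.2.1 : ℕ) : ℝ))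
    (h : a.2.1 + d ≤ b.1) : x + (d : ℝ) ≤ y := by
  have h' : ((a.2.1 : ℕ) : ℝ) + (d : ℝ) ≤ ((b.1 : ℕ) : ℝ) := by exact_mod_cast h
  linarith [ha.2, hb.1]

/-- The generic step: a `gapChain d` on a sorted copy of `l.map f` separates the `f`-images of two distinct members of `l`.
[folklore] -/
theorem sep_of_gapChain_perm {α : Type} {l : List α} {f : α → Enc} {S : List Enc} {d : ℕ} (hd : 1 ≤ d)
    (hS : S.Perm (l.map f)) (hc : gapChain d S = true) {a b : α} (ha : a ∈ l) (hb : b ∈ l) (hne : a ≠ b) :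
    (f a).2.1 + d ≤ (f b).1 ∨ (f b).2.1 + d ≤ (f a).1 := by
  obtain ⟨-, hp⟩ := gapChain_pairwise hc
  have hnd : (l.map f).Nodup := hS.nodup_iff.mp (nodup_of_gapChain hd hc)
  have hfne : f a ≠ f b := fun heq => hne (List.inj_on_of_nodup_map hnd ha hb heq)
  have hma : f a ∈ S := hS.mem_iff.mpr (List.mem_map_of_mem ha)
  have hmb : f b ∈ S := hS.mem_iff.mpr (List.mem_map_of_mem hb)
  exact rel_or_rel_of_pairwise hp hma hmb hfne

/-- **Soundness of the `LIN` part check.** [folklore] -/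
theorem linPartChk_sound {Wlo Whi : ℕ} (hW : 3 * 10 ^ 9 * lcm32 ≤ Wlo) (h : linPartChk Wlo Whi = true) :
    PartSepL Wlo Whi := by
  have hpL : (msortT ((linGen Wlo Whi).map Prod.snd)).Perm ((linTupGen Wlo Whi).map linEncOf) := by
    rw [← linGen_map_snd]; exact msortT_perm _
  intro e e' hok hprim hok' hprim' hne hlo hhi hlo' hhi'
  have he := linTupGen_complete hW hok hprim hlo hhi
  have he' := linTupGen_complete hW hok' hprim' hlo' hhi'
  have be := (linTupGen_sound he).2.2
  have be' := (linTupGen_sound he').2.2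
  rcases sep_of_gapChain_perm (by norm_num [dL]) hpL h he he' hne with hr | hr
  · exact Or.inl (val_sep_of_enc_sep be be' hr)
  · exact Or.inr (val_sep_of_enc_sep be' be hr)

/-- **Soundness of the `TRG` part check.** [folklore] -/
theorem trgPartChk_sound {Wlo Whi : ℕ} (hW : 3 * 10 ^ 9 * lcm32 ≤ Wlo) (h : trgPartChk Wlo Whi = true) :
    PartSepT Wlo Whi := by
  have hW0 : 0 < Wlo := lt_of_lt_of_le (by unfold lcm32; norm_num) hW
  have hpT : (msortT ((trgGen Wlo Whi).map Prod.snd)).Perm ((trgTupGen Wlo Whi).map trgEncOf) := by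
    rw [← trgGen_map_snd]; exact msortT_perm _
  have h2 : gapChain dT (msortT ((trgGen Wlo Whi).map Prod.snd)) = true := h
  intro e e' hok hcan hprim hok' hcan' hprim' hne hlo hhi hlo' hhi'
  have he := trgTupGen_complete hW0 hok hcan hprim hlo hhi
  have he' := trgTupGen_complete hW0 hok' hcan' hprim' hlo' hhi'
  have be := (trgTupGen_sound he).2.2.2
  have be' := (trgTupGen_sound he').2.2.2
  rcases sep_of_gapChain_perm (by norm_num [dT]) hpT h2 he he' hne with hr | hr
  · exact Or.inl (val_sep_of_enc_sep be be' hr)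
  · exact Or.inr (val_sep_of_enc_sep be' be hr)

/-- **Soundness of the mixed part check.** [folklore] -/
theorem crossPartChk_sound {cls : List ℕ} (hcls : ∀ i ∈ cls, i < 7) {Wlo Whi : ℕ} (hW : 3 * 10 ^ 9 * lcm32 ≤ Wlo)
    (h : crossPartChk cls Wlo Whi = true) : PartSepX cls Wlo Whi := by
  set sL := msortT ((linGenG cls Wlo Whi).map Prod.snd) with hsL
  set sT := msortT ((trgGen Wlo Whi).map Prod.snd) with hsT
  set sG := mergeT 10000000 (sL.filter fun e => e.2.2 == 0) sT with hsG
  unfold crossPartChk at h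
  rw [← hsL, ← hsT, ← hsG] at h
  obtain ⟨h3, h4⟩ := gapCrossChain_split h
  have hW0 : 0 < Wlo := lt_of_lt_of_le (by unfold lcm32; norm_num) hW
  have hpL : sL.Perm ((linTupGenG cls Wlo Whi).map linEncOf) := by rw [← linGenG_map_snd hcls]; exact msortT_perm _
  have hpT : sT.Perm ((trgTupGen Wlo Whi).map trgEncOf) := by rw [← trgGen_map_snd]; exact msortT_perm _
  -- non-form LIN of the group – TRG: the merged list
  intro e e' hok hprim htrg hcl hok' hcan' hprim' hlo hhi hlo' hhi'
  have he := linTupGenG_complete hW hok hprim hcl hlo hhi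
  have he' := trgTupGen_complete hW0 hok' hcan' hprim' hlo' hhi'
  have be := (linTupGenG_sound hcls he).2.2
  have be' := (trgTupGen_sound he').2.2.2
  have hpG : sG.Perm ((sL.filter fun x => x.2.2 == 0) ++ sT) := mergeT_perm _ _ _
  obtain ⟨hwf, hp3⟩ := gapChain_pairwise h3
  have hord : sG.Pairwise (fun a b => a.2.1 ≤ b.1) := hp3.imp (fun hab => le_of_add_le_left hab)
  have hpX := crossChain_pairwise h4 hwf hord
  have tagL : (linEncOf e).2.2 = 0 := by unfold linEncOf; simp [htrg]
  have tagT : (trgEncOf e').2.2 = 1 := by obtain ⟨p, q, u, a, g, b, L, s⟩ := e'; rfl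
  have hma : linEncOf e ∈ sG := by
    refine hpG.mem_iff.mpr (List.mem_append_left _ (List.mem_filter.mpr ⟨?_, by simp [tagL]⟩))
    exact hpL.mem_iff.mpr (List.mem_map_of_mem he)
  have hmb : trgEncOf e' ∈ sG :=
    hpG.mem_iff.mpr (List.mem_append_right _ (hpT.mem_iff.mpr (List.mem_map_of_mem he')))
  have hne : linEncOf e ≠ trgEncOf e' := by
    intro heq
    have h := tagL
    rw [heq, tagT] at h
    exact absurd h (by norm_num)
  have htag : (linEncOf e).2.2 ≠ (trgEncOf e').2.2 := by rw [tagL, tagT]; norm_num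
  rcases rel_or_rel_of_pairwise hpX hma hmb hne with hr | hr
  · exact Or.inl (val_sep_of_enc_sep be be' (hr htag))
  · exact Or.inr (val_sep_of_enc_sep be' be (hr htag.symm))

end ColumnFaceL11
end Summit.CriticalPhenomena.Ising3D
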